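import Mathlib
import Summits.CriticalPhenomena.CardyFormulaZ2.Theorems.CardySelfRefinementGradientComparabilityStubNonAxialShareBulkDispatch
import Summits.CriticalPhenomena.CardyFormulaZ2.Theorems.CardySelfRefinementGradientComparabilityStubBulkPivotalSumDivergesSmall
import HarnessLib

/-!
# Local surgery around a pivotal axial edge of the localised joint crossing event

Helper file for the stub `stub_nonAxialShare_bulk` (D4-bulk) of the line `Sketch` (crux
`stmt-CriticalPhenomena-10269`, `…Theses.CardySelfRefinement.GradientComparability`), continuing
`…BulkDispatch.lean`: the deterministic heart of the bulk transfer, **`local_modification`**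
(registered sub-goal).  Let `e = edgeOf (v, d)` be an axial edge whose ends are `r`-far
(`r ≥ 20η`) from every side of every quad of the family `F`, pivotal in `ω` for the localised joint
crossing event `Aloc m F η` (vocabulary of `CardySelfRefinementDefs`; crossing in the
Schramm–Smirnov `configOf` sense at mesh `η`, i.e. raw crossings inside the drawing
`openEdgeUnion (η√2)`, `mem_configOf_iff_exists_isCrossing_openEdgeUnion`; drawn positions `eta_mul_z_eq_meshPoint`).  Then
`(ω ∪ {e}) ∩ window` crosses every `F i` and `(ω ∖ {e}) ∩ window` fails some `F i₀`; the `r`-ball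
around the drawn `v` meets no side, hence lies in `[F i]°` or off `[F i]` for each `i`
(`ball_subset_interior_or_disjoint`), inside for `i₀`; the two ends of `e` are linked to opposite
sides of `F i₀` (`endpoint_links`); `dispatch` supplies sets `Rm ∋ e`, `S ∋ e'` of genuine edges
within four steps of `v`, `e'` NON-AXIAL, with `S` a connected drawn detour through the ends of
`Rm` and `((ω ∖ {e}) ∩ window ∖ Rm) ∪ (S ∖ {e'})` not crossing `F i₀`.  In the configuration
`ω' = (ω ∖ Rm) ∪ S` every quad stays crossed (`crossing_reroute` for the quads containing the
ball, nothing changes for the others) while closing `e'` fails `F i₀`: `e'` is pivotal for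
`Aloc m F η` in `ω'`.

No named fact.
-/

noncomputable section

namespace Summit.CriticalPhenomena.CardyFormulaZ2.Theorems.CardySelfRefinement

open scoped Topology
open Filter Set MeasureTheory Metric
open Literature.Probability.LatticeModels Literature.Probability.Percolation
open Literature.Probability.Percolation.QuadCrossing
open Summit.CriticalPhenomena.CardyFormulaZ2.Theses.CardySelfRefinement

variable {D : Set ℂ} {δ : ℝ}


/-! ## From a pivotal axial bulk edge of `Aloc` to a pivotal non-axial edge nearby -/

/-- **Local modification.**  Let `e = edgeOf (v, d)` be an axial edge whose ends are at distance
`≥ r ≥ 20η` from every side of every quad of the family, pivotal for the localised joint crossing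
event `Aloc m F η` in `ω`.  Then some NON-AXIAL edge `e'` within four lattice steps of `v` is
pivotal for `Aloc m F η` in a configuration `(ω ∖ Rm) ∪ S` obtained from `ω` by closing and
opening genuine edges within four steps of `v`.  (Pivotality of `e` means: `(ω ∪ {e}) ∩ window`
crosses every `F i` and `(ω ∖ {e}) ∩ window` fails some `F i₀`, in the drawing at mesh `η√2`;
the `r`-ball around the drawn `v` meets no side, so it lies inside `[F i]°` or off `[F i]` for
each `i`, inside for `i₀`; `dispatch` supplies the modification, `crossing_reroute` keeps every
quad crossed, and the failing quad stays failed once `e'` is closed.) -/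
theorem local_modification {k : ℕ} (hk : k = 2 ∨ k = 3) {m : ℕ} (F : Fin m → Quad (Set.univ : Set ℂ))
    {r η : ℝ} (hη : 0 < η) (hηr : 20 * η ≤ r) {v : Site 2} {d : Fin 2} (hax : ax k (v, d))
    (hfar : ∀ x ∈ edgeOf (v, d), ∀ (i : Fin m) (j : Fin 4), ∀ q ∈ (F i).side j,
      r ≤ dist ((η : ℂ) * squareLatticeEmbedding.z x) q)
    {ω : BondConfig (Site 2)} (hpiv : IsPivotal (Aloc m F η) (edgeOf (v, d)) ω) :
    ∃ (Rm S : Set (Sym2 (Site 2))) (e' : Sym2 (Site 2)),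
      (∃ v' d', e' = edgeOf (v', d') ∧ ¬ ax k (v', d') ∧ ∀ i, |v' i - v i| ≤ 4) ∧
      (∀ x ∈ Rm ∪ S, ∃ a b, x = s(a, b) ∧ (zdGraph 2).Adj a b ∧
        ∀ i, |a i - v i| ≤ 4 ∧ |b i - v i| ≤ 4) ∧
      IsPivotal (Aloc m F η) e' ((ω \ Rm) ∪ S) := by
  classical
  -- notation
  set dd : ℝ := η * Real.sqrt 2 with hdd_def
  have hdd : 0 < dd := by positivity
  have hsqrt : Real.sqrt 2 < 3 / 2 := (Real.sqrt_lt' (by norm_num)).2 (by norm_num)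
  have hsqrt1 : 1 ≤ Real.sqrt 2 := Real.one_le_sqrt.2 (by norm_num)
  have hddr : 10 * dd < r := by rw [hdd_def]; nlinarith
  have hηdd : η ≤ dd := by rw [hdd_def]; nlinarith
  set e : Sym2 (Site 2) := edgeOf (v, d) with he_def
  have he_eq : e = s(v, v + dirVec d) := rfl
  set W : Set (Sym2 (Site 2)) := window m F η with hW_def
  have hW : W ⊆ (zdGraph 2).edgeSet := Set.iUnion_subset fun i => Set.inter_subset_right
  have hadj_e : (zdGraph 2).Adj v (v + dirVec d) := by
    have := frame_adj (V := fun a b => v + a • dirVec d + b • dirVec (1 - d)) (fun _ _ => rfl)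
      (frame_std d) (a := 0) (b := 0) (a' := 1) (b' := 0) (by norm_num)
    simpa using this
  -- pivotality: in and out
  have h1 : insert e ω ∈ Aloc m F η ∧ ω \ {e} ∉ Aloc m F η := by
    rcases hpiv with ⟨ha, hb⟩ | ⟨ha, hb⟩
    · exact ⟨ha, hb⟩
    · exact absurd (isUpperSet_Aloc m F η (Set.sdiff_subset.trans (Set.subset_insert e ω)) ha) hb
  obtain ⟨hin, hout⟩ := h1
  have hin' : ∀ i, F i ∈ configOf squareLatticeEmbedding.z η Set.univ (insert e ω ∩ W) := hin
  have hout' : ¬ ∀ i, F i ∈ configOf squareLatticeEmbedding.z η Set.univ (ω \ {e} ∩ W) := hout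
  obtain ⟨i₀, hi₀⟩ := not_forall.1 hout'
  set σ : BondConfig (Site 2) := ω \ {e} ∩ W with hσ_def
  have hσE : σ ⊆ (zdGraph 2).edgeSet := Set.inter_subset_right.trans hW
  have hσpE : insert e ω ∩ W ⊆ (zdGraph 2).edgeSet := Set.inter_subset_right.trans hW
  rw [mem_configOf_iff_exists_isCrossing_openEdgeUnion hη hσE] at hi₀
  have hinK : ∀ i, ∃ K, (F i).IsCrossing K ∧ K ⊆ openEdgeUnion dd (insert e ω ∩ W) := fun i =>
    (mem_configOf_iff_exists_isCrossing_openEdgeUnion hη hσpE (F i)).1 (hin' i)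
  have heσ : e ∉ σ := fun h => h.1.2 rfl
  have hsub_e : insert e ω ∩ W ⊆ σ ∪ {e} := by
    rintro x ⟨hx, hxW⟩
    rcases Set.mem_insert_iff.1 hx with rfl | hxω
    · exact Or.inr rfl
    · by_cases hxe : x = e
      · exact Or.inr hxe
      · exact Or.inl ⟨⟨hxω, hxe⟩, hxW⟩
  -- geometry: the `r`-ball around the drawn `v`
  have hfar_v : ∀ (i : Fin m) (j : Fin 4), ∀ q ∈ (F i).side j, r ≤ dist (meshPoint dd v) q :=
    fun i j q hq => by
      rw [← eta_mul_z_eq_meshPoint]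
      exact hfar v (by rw [he_eq]; exact Sym2.mem_mk_left _ _) i j q hq
  have hball_alt : ∀ i, Metric.ball (meshPoint dd v) r ⊆ interior (F i).carrier ∨
      ∀ w ∈ Metric.ball (meshPoint dd v) r, w ∉ (F i).carrier := fun i =>
    ball_subset_interior_or_disjoint (F i) (fun j q hq => hfar_v i j q hq)
  -- drawn points within seven steps of `v` are in the ball
  have hnear_ball : ∀ x : Site 2, (∀ i, |x i - v i| ≤ 4) → ∀ y, (zdGraph 2).Adj x y →
      segment ℝ (meshPoint dd x) (meshPoint dd y) ⊆ Metric.ball (meshPoint dd v) r := by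
    intro x hx y hxy
    have hxv : dist (meshPoint dd x) (meshPoint dd v) ≤ dd * 8 := by
      refine (dist_meshPoint_le hdd.le x v).trans ?_
      have h0 : |((x 0 : ℤ) : ℝ) - v 0| ≤ 4 := by exact_mod_cast hx 0
      have h1 : |((x 1 : ℤ) : ℝ) - v 1| ≤ 4 := by exact_mod_cast hx 1
      nlinarith
    have hyv : dist (meshPoint dd y) (meshPoint dd v) ≤ dd * 9 := by
      have h := dist_triangle (meshPoint dd y) (meshPoint dd x) (meshPoint dd v)
      have h' : dist (meshPoint dd y) (meshPoint dd x) ≤ dd := by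
        rw [dist_comm]; exact dist_meshPoint_le_of_mem_segment hdd hxy (right_mem_segment ℝ _ _)
      linarith
    refine (convex_ball (meshPoint dd v) r).segment_subset ?_ ?_ <;> rw [Metric.mem_ball] <;> linarith
  have hv_near : ∀ i, |v i - v i| ≤ 4 := fun i => by simp
  have hy_near : ∀ i, |(v + dirVec d) i - v i| ≤ 4 := fun i =>
    (abs_add_dirVec_sub_le v d i).trans (by norm_num)
  have hseg_e : segment ℝ (meshPoint dd v) (meshPoint dd (v + dirVec d)) ⊆ Metric.ball (meshPoint dd v) r :=
    hnear_ball v hv_near _ hadj_e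
  -- the failing quad contains the ball
  have hbulk₀ : Metric.ball (meshPoint dd v) r ⊆ interior (F i₀).carrier := by
    rcases hball_alt i₀ with h | h
    · exact h
    · exfalso
      refine hi₀ (crossing_of_subset_union_of_disjoint dd (F i₀) (R := {e}) hsub_e (fun z hz => ?_) (hinK i₀))
      rw [he_eq] at hz
      exact h z (hseg_e (openEdgeUnion_singleton_subset dd _ _ hz))
  have hballs : ∀ p : Site 2, dist (meshPoint dd p) (meshPoint dd v) ≤ dd →
      Metric.closedBall (meshPoint dd p) (4 * dd) ⊆ interior (F i₀).carrier := fun p hp z hz => by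
    refine hbulk₀ (Metric.mem_ball.2 ?_)
    have := dist_triangle z (meshPoint dd p) (meshPoint dd v)
    rw [Metric.mem_closedBall] at hz
    linarith
  have hballv := hballs v (by rw [dist_self]; exact hdd.le)
  have hbally := hballs (v + dirVec d) (by
    rw [dist_comm]; exact dist_meshPoint_le_of_mem_segment hdd hadj_e (right_mem_segment ℝ _ _))
  -- the failing quad in path form
  have hσ : ¬ ∃ a ∈ (F i₀).side 0, ∃ b ∈ (F i₀).side 2,
      JoinedIn ((F i₀).carrier ∩ openEdgeUnion dd σ) a b :=
    fun h => hi₀ ((exists_isCrossing_iff_joinedIn hdd (F i₀) σ).2 h)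
  have hcr : ∃ a ∈ (F i₀).side 0, ∃ b ∈ (F i₀).side 2,
      JoinedIn ((F i₀).carrier ∩ openEdgeUnion dd (σ ∪ {s(v, v + dirVec d)})) a b := by
    rw [← he_eq]
    refine (exists_isCrossing_iff_joinedIn hdd (F i₀) _).1 ?_
    obtain ⟨K, hK, hKσ⟩ := hinK i₀
    exact ⟨K, hK, hKσ.trans (openEdgeUnion_mono dd hsub_e)⟩
  have hax' : (k : ℤ) ∣ v (if d = 0 then 1 else 0) := hax
  -- dispatch, in the orientation dictated by the links of the two ends
  obtain ⟨Rm, S, e', heRm, he'S, hAdm, hnear, hSconn, hends, hnc⟩ :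
      ∃ (Rm S : Set (Sym2 (Site 2))) (e' : Sym2 (Site 2)), s(v, v + dirVec d) ∈ Rm ∧ e' ∈ S ∧
        (∃ v' d', e' = edgeOf (v', d') ∧ ¬ ax k (v', d') ∧ ∀ i, |v' i - v i| ≤ 4) ∧
        (∀ r ∈ Rm ∪ S, ∃ x y, r = s(x, y) ∧ (zdGraph 2).Adj x y ∧
          ∀ i, |x i - v i| ≤ 4 ∧ |y i - v i| ≤ 4) ∧
        IsPreconnected (openEdgeUnion dd S) ∧ (∀ r ∈ Rm, ∀ x ∈ r, meshPoint dd x ∈ openEdgeUnion dd S) ∧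
        ¬ ∃ a ∈ (F i₀).side 0, ∃ b ∈ (F i₀).side 2,
          JoinedIn ((F i₀).carrier ∩ openEdgeUnion dd (σ \ Rm ∪ (S \ {e'}))) a b := by
    rcases endpoint_links hdd (F i₀) (by rw [← he_eq]; exact heσ) (hseg_e.trans hbulk₀) hσ hcr with
      ⟨hvL, hvR, hyR, hyL⟩ | ⟨hvR, hvL, hyL, hyR⟩
    · exact dispatch hk hdd (F i₀) (jp := 0) (jq := 2) (Or.inl ⟨rfl, rfl⟩) hσ hax' hballv hbally
        (by rw [← he_eq]; exact heσ) hvL hvR hyR hyL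
    · exact dispatch hk hdd (F i₀) (jp := 2) (jq := 0) (Or.inr ⟨rfl, rfl⟩) hσ hax' hballv hbally
        (by rw [← he_eq]; exact heσ) hvR hvL hyL hyR
  -- the new edges are window edges drawn in the ball
  have hRS_ball : ∀ x ∈ Rm ∪ S, ∀ z ∈ openEdgeUnion dd {x}, z ∈ Metric.ball (meshPoint dd v) r := by
    intro x hx z hz
    obtain ⟨a, b, rfl, hab, hnr⟩ := hnear x hx
    exact hnear_ball a (fun i => (hnr i).1) b hab (openEdgeUnion_singleton_subset dd a b hz)
  have hS_W : S ⊆ W := fun x hx => by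
    obtain ⟨a, b, rfl, hab, hnr⟩ := hnear x (Or.inr hx)
    refine Set.mem_iUnion.2 ⟨i₀, ⟨a, b, rfl, ⟨meshPoint dd a, ?_, ?_⟩⟩, (SimpleGraph.mem_edgeSet _).2 hab⟩
    · rw [eta_mul_z_eq_meshPoint, eta_mul_z_eq_meshPoint]
      exact left_mem_segment ℝ _ _
    · exact Metric.self_subset_thickening (by norm_num) _ (interior_subset (hbulk₀
        (hnear_ball a (fun i => (hnr i).1) b hab (left_mem_segment ℝ _ _))))
  -- the modified configuration
  set ω' : BondConfig (Site 2) := ω \ Rm ∪ S with hω'_def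
  have he'ω' : e' ∈ ω' := Or.inr he'S
  have hins : insert e' ω' = ω' := Set.insert_eq_of_mem he'ω'
  have hω'W : ω' ∩ W ⊆ (zdGraph 2).edgeSet := Set.inter_subset_right.trans hW
  -- (a) every quad stays crossed
  have hall : ∀ i, F i ∈ configOf squareLatticeEmbedding.z η Set.univ (ω' ∩ W) := by
    intro i
    rw [mem_configOf_iff_exists_isCrossing_openEdgeUnion hη hω'W]
    have hsub : insert e ω ∩ W ⊆ ω' ∩ W ∪ Rm := by
      rintro x ⟨hx, hxW⟩
      rcases Set.mem_insert_iff.1 hx with rfl | hxω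
      · exact Or.inr (he_eq ▸ heRm)
      · by_cases hxR : x ∈ Rm
        · exact Or.inr hxR
        · exact Or.inl ⟨Or.inl ⟨hxω, hxR⟩, hxW⟩
    rcases hball_alt i with hI | hO
    · -- bulk quad: reroute through the patch `openEdgeUnion dd S`
      have hRm_int : openEdgeUnion dd Rm ⊆ interior (F i).carrier := fun z hz => by
        obtain ⟨a, b, hab, hx, hz⟩ := mem_openEdgeUnion_iff.1 hz
        exact hI (hRS_ball _ (Or.inl hx) z (segment_subset_openEdgeUnion' dd hab (Set.mem_singleton _) hz))
      have hS_ball : openEdgeUnion dd S ⊆ Metric.ball (meshPoint dd v) r := fun z hz => by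
        obtain ⟨a, b, hab, hx, hz⟩ := mem_openEdgeUnion_iff.1 hz
        exact hRS_ball _ (Or.inr hx) z (segment_subset_openEdgeUnion' dd hab (Set.mem_singleton _) hz)
      refine crossing_reroute hdd (F i) hsub
        (Metric.isCompact_of_isClosed_isBounded (isClosed_openEdgeUnion hdd S)
          (Metric.isBounded_ball.subset hS_ball))
        hSconn ((hS_ball.trans hI).trans interior_subset)
        (openEdgeUnion_mono dd fun x hx => ⟨Or.inr hx, hS_W hx⟩) (fun z hz hzR => ?_)
        (fun z hz => ⟨notMem_side_of_mem_interior (F i) (hRm_int hz) 0,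
          notMem_side_of_mem_interior (F i) (hRm_int hz) 2⟩) (hinK i)
      -- where the new drawing meets the drawing of `Rm`
      have hz' : z ∈ openEdgeUnion dd ((ω \ Rm) ∩ W) ∪ openEdgeUnion dd S := by
        rw [← openEdgeUnion_union]
        refine openEdgeUnion_mono dd (fun x hx => ?_) hz
        rcases hx.1 with h | h
        exacts [Or.inl ⟨h, hx.2⟩, Or.inr h]
      rcases hz' with hz' | hz'
      · obtain ⟨x, hzx, ⟨y, -, hxR⟩, -⟩ := exists_vertex_of_mem_inter hdd (S := Rm) (T := (ω \ Rm) ∩ W)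
          (fun f hf hT => hT.1.2 hf) hzR hz'
        rw [hzx]
        exact hends _ hxR x (Sym2.mem_mk_left _ _)
      · exact hz'
    · -- far quad: nothing drawn near `e` matters
      exact crossing_of_subset_union_of_disjoint dd (F i) hsub
        (fun z hz hzQ => by
          obtain ⟨a, b, hab, hx, hz⟩ := mem_openEdgeUnion_iff.1 hz
          exact hO z (hRS_ball _ (Or.inl hx) z (segment_subset_openEdgeUnion' dd hab (Set.mem_singleton _) hz)) hzQ)
        (hinK i)
  -- (b) closing `e'` makes the failing quad fail
  have hfail : F i₀ ∉ configOf squareLatticeEmbedding.z η Set.univ ((ω' \ {e'}) ∩ W) := by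
    have hE : (ω' \ {e'}) ∩ W ⊆ (zdGraph 2).edgeSet := Set.inter_subset_right.trans hW
    rw [mem_configOf_iff_exists_isCrossing_openEdgeUnion hη hE, exists_isCrossing_iff_joinedIn hdd]
    rintro ⟨a, ha, b, hb, hJ⟩
    refine hnc ⟨a, ha, b, hb, joinedIn_mono_config dd (F i₀) ?_ hJ⟩
    rintro x ⟨⟨hx | hx, hxe'⟩, hxW⟩
    · refine Or.inl ⟨⟨⟨hx.1, fun hxe => hx.2 ?_⟩, hxW⟩, hx.2⟩
      rw [Set.mem_singleton_iff.1 hxe, he_eq]; exact heRm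
    · exact Or.inr ⟨hx, hxe'⟩
  refine ⟨Rm, S, e', hAdm, hnear, Or.inl ⟨?_, fun h => hfail (h i₀)⟩⟩
  rw [hins]
  exact hall

end Summit.CriticalPhenomena.CardyFormulaZ2.Theorems.CardySelfRefinement

end
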